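import Literature.AlgebraicTopology.Homotopy.SimplicialNeighbourhoodRetract
import Literature.Analysis.Convexity.BarycentricSubdivision
import HarnessLib

/-!
# A subcomplex is a strong deformation retract of arbitrarily small neighbourhoods in the polyhedron

Topic `Literature/AlgebraicTopology/Homotopy`; sequel of `SimplicialNeighbourhoodRetract.lean`
(`SimplicialRetract.isStrongDeformationRetractOf_zeroSet_sublevel`: the zero set of a non-negative
simplexwise affine function on a finite complex is a strong deformation retract of its small
sublevel sets, which are cofinal neighbourhoods of it). Here the classical corollary for an
ARBITRARY subcomplex `K₀ ≤ K` of a finite geometric simplicial complex (Munkres, *Elements of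
Algebraic Topology*, Lemma 70.1 with §15; Rourke–Sanderson, Cor. 3.30; van den Dries, *Tame
Topology*, Ch. 8 (3.3)–(3.4)):

**Theorem** (`exists_isStrongDeformationRetractOf_nhds_subcomplex`). For `K` finite, `K₀ ≤ K` and
every open `O ⊇ |K₀|` there is a relatively open `V`, `|K₀| ⊆ V ⊆ |K| ∩ O`, of which `|K₀|` is a
strong deformation retract.

Proof: pass to the first derived subdivisions `sd K₀ ≤ sd K` (the tree's
`Analysis.Convexity.BarycentricSubdivision`: `sd`, `sd_mono`, `space_sd`, `mem_vertices_sd_iff`,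
`bary_injOn`), in which `sd K₀` is FULL (`mem_sd_of_forall_mem_vertices`: a chain simplex of `sd K`
all of whose vertices are centroids of simplices of `K₀` is a chain of `K₀`); the simplexwise affine
interpolation `awayFn K K₀` of the indicator of the vertices outside `sd K₀` (Munkres's
`Σ_{v ∉ K₀} t_v`) is `≥ 0` with zero set exactly `|sd K₀| = |K₀|` by fullness
(`setOf_awayFn_eq_zero`), and the general sublevel retraction applies. Everything is proved; no
named fact is introduced. This is input (D2)/(A') of the retraction theorem
`Literature.AlgebraicGeometry.HodgeTheory.exists_homotopyEquiv_fiberToTube` once a compact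
neighbourhood of the special fibre is triangulated with the fibre as a subcomplex.

## References

* J. R. Munkres, *Elements of Algebraic Topology* (1984), §15 (barycentric subdivision),
  Lemma 70.1. [Munkres1984]
* C. P. Rourke, B. J. Sanderson, *Introduction to Piecewise-Linear Topology* (1972), 2.4–2.5,
  Cor. 3.30. [RourkeSanderson1972]
* L. van den Dries, *Tame Topology and O-minimal Structures* (1998), Ch. 8 (3.3)–(3.4). [Dries1998]
-/

noncomputable section

open Set Function
open scoped Topology

namespace Literature.AlgebraicTopology.Homotopy

open Literature.Analysis.Convexity

namespace SimplicialRetract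

variable {W : Type*} [NormedAddCommGroup W] [NormedSpace ℝ W] [FiniteDimensional ℝ W] [DecidableEq W]
variable {K K₀ : Geometry.SimplicialComplex ℝ W}

/-! ### Fullness of `sd K₀` in `sd K` -/

omit [FiniteDimensional ℝ W] in
/-- **The derived subdivision of a subcomplex is full**: a simplex of `sd K` all of whose vertices
are vertices of `sd K₀` (i.e. centroids of simplices of `K₀`) is a simplex of `sd K₀` — its chain
is a chain of simplices of `K₀` (centroids determine simplices, `bary_injOn`).
[cite: Munkres1984, §15] -/
theorem mem_sd_of_forall_mem_vertices (h : K₀ ≤ K) {σ : Finset W} (hσ : σ ∈ (sd K).faces)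
    (hv : ∀ v ∈ σ, v ∈ (sd K₀).vertices) : σ ∈ (sd K₀).faces := by
  classical
  obtain ⟨C, hne, hCK, hC, rfl⟩ := hσ
  refine ⟨C, hne, fun G hG => ?_, hC, rfl⟩
  obtain ⟨F, hF, hFG⟩ := mem_vertices_sd_iff.1 (hv (bary G) (Finset.mem_image_of_mem bary hG))
  rw [← bary_injOn (h hF) (hCK G hG) hFG]
  exact hF

omit [FiniteDimensional ℝ W] [DecidableEq W] in
/-- Vertices of a simplex of `sd K₀` are vertices of `sd K₀`. [folklore] -/
theorem mem_vertices_of_mem_face {L : Geometry.SimplicialComplex ℝ W} {τ : Finset W}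
    (hτ : τ ∈ L.faces) {v : W} (hv : v ∈ τ) : v ∈ L.vertices := by
  rw [Geometry.SimplicialComplex.vertices_eq]
  exact Set.mem_biUnion hτ hv

/-! ### The PL distance from the subcomplex -/

/-- The **PL distance from `K₀`**: the simplexwise affine interpolation on `sd K` of the indicator
of the vertices outside `sd K₀` (Munkres's `Σ_{v ∉ K₀} t_v(x)`). [cite: Munkres1984, Lemma 70.1] -/
def awayFn (K K₀ : Geometry.SimplicialComplex ℝ W) : W → ℝ :=
  plMap (sd K) (Set.indicator ((sd K₀).verticesᶜ) (1 : W → ℝ))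

omit [FiniteDimensional ℝ W] in
/-- The vertex data of `awayFn` vanish on the vertices of `sd K₀`. [folklore] -/
theorem indicator_vertices_of_mem {v : W} (hv : v ∈ (sd K₀).vertices) :
    Set.indicator ((sd K₀).verticesᶜ) (1 : W → ℝ) v = 0 :=
  Set.indicator_of_notMem (show v ∉ (sd K₀).verticesᶜ from fun h => h hv) _

omit [FiniteDimensional ℝ W] in
/-- The vertex data of `awayFn` are `1` off the vertices of `sd K₀`. [folklore] -/
theorem indicator_vertices_of_not_mem {v : W} (hv : v ∉ (sd K₀).vertices) :
    Set.indicator ((sd K₀).verticesᶜ) (1 : W → ℝ) v = 1 := by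
  rw [Set.indicator_of_mem (show v ∈ (sd K₀).verticesᶜ from hv)]
  rfl

omit [FiniteDimensional ℝ W] in
/-- The vertex data are non-negative. [folklore] -/
theorem indicator_vertices_nonneg (v : W) : 0 ≤ Set.indicator ((sd K₀).verticesᶜ) (1 : W → ℝ) v := by
  by_cases hv : v ∈ (sd K₀).vertices
  · rw [indicator_vertices_of_mem hv]
  · rw [indicator_vertices_of_not_mem hv]
    exact zero_le_one

/-- `awayFn` is affine on every closed simplex of `sd K`. [folklore] -/
theorem exists_affineMap_eqOn_awayFn {σ : Finset W} (hσ : σ ∈ (sd K).faces) :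
    ∃ A : W →ᵃ[ℝ] ℝ, EqOn (awayFn K K₀) A (convexHull ℝ (σ : Set W)) := by
  obtain ⟨A, hA, -⟩ := exists_affineMap_eqOn_plMap (K := sd K) (g := Set.indicator
    ((sd K₀).verticesᶜ) (1 : W → ℝ)) hσ
  exact ⟨A, hA⟩

/-- `awayFn` agrees with the vertex data on the vertices of `sd K`. [folklore] -/
theorem awayFn_apply_of_mem_vertices {v : W} (hv : v ∈ (sd K).vertices) :
    awayFn K K₀ v = Set.indicator ((sd K₀).verticesᶜ) (1 : W → ℝ) v := by
  rw [Geometry.SimplicialComplex.mem_vertices] at hv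
  exact plMap_apply_of_mem hv (Finset.mem_singleton_self v)

/-- `awayFn ≥ 0` on the vertices of `sd K`. [folklore] -/
theorem awayFn_nonneg_of_mem_vertices {v : W} (hv : v ∈ (sd K).vertices) : 0 ≤ awayFn K K₀ v := by
  rw [awayFn_apply_of_mem_vertices hv]
  exact indicator_vertices_nonneg v

/-- On a closed simplex of `sd K`, `awayFn` is the convex combination of its vertex data.
[folklore] -/
theorem awayFn_sum_smul {σ : Finset W} (hσ : σ ∈ (sd K).faces) {w : W → ℝ}
    (hw0 : ∀ u ∈ σ, 0 ≤ w u) (hw1 : ∑ u ∈ σ, w u = 1) :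
    awayFn K K₀ (∑ u ∈ σ, w u • u) =
      ∑ u ∈ σ, w u * Set.indicator ((sd K₀).verticesᶜ) (1 : W → ℝ) u := by
  have h := plMap_sum_smul (K := sd K) (g := Set.indicator ((sd K₀).verticesᶜ) (1 : W → ℝ))
    hσ hw0 hw1
  simpa only [awayFn, smul_eq_mul] using h

/-- **The zero set of the PL distance is the subcomplex** (fullness of `sd K₀` in `sd K`):
`{x ∈ |sd K| : awayFn x = 0} = |K₀|`. [cite: Munkres1984, Lemma 70.1] -/
theorem setOf_awayFn_eq_zero (h : K₀ ≤ K) :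
    {x ∈ (sd K).space | awayFn K K₀ x = 0} = K₀.space := by
  classical
  ext x
  constructor
  · rintro ⟨hx, hx0⟩
    obtain ⟨σ, hσ, w, hw0, hw1, rfl⟩ := exists_eq_sum_smul_of_mem_space hx
    rw [awayFn_sum_smul hσ hw0 hw1] at hx0
    have hterm := (Finset.sum_eq_zero_iff_of_nonneg fun u hu =>
      mul_nonneg (hw0 u hu) (indicator_vertices_nonneg u)).1 hx0
    -- the face of the vertices with positive weight lies in `sd K₀` by fullness
    set τ := σ.filter fun u => 0 < w u with hτ
    have hτσ : τ ⊆ σ := Finset.filter_subset _ _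
    have hτne : τ.Nonempty := by
      by_contra hne
      rw [Finset.not_nonempty_iff_eq_empty] at hne
      have hzero : ∀ u ∈ σ, w u = 0 := fun u hu => by
        by_contra hwu
        have hpos : 0 < w u := lt_of_le_of_ne (hw0 u hu) (Ne.symm hwu)
        have : u ∈ τ := Finset.mem_filter.2 ⟨hu, hpos⟩
        rw [hne] at this
        simp at this
      rw [Finset.sum_eq_zero hzero] at hw1
      exact zero_ne_one hw1
    have hτK : τ ∈ (sd K).faces := (sd K).down_closed hσ hτσ hτne
    have hτv : ∀ u ∈ τ, u ∈ (sd K₀).vertices := fun u hu => by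
      obtain ⟨huσ, hpos⟩ := Finset.mem_filter.1 hu
      have h0 := hterm u huσ
      by_contra hnot
      rw [indicator_vertices_of_not_mem hnot, mul_one] at h0
      exact (ne_of_gt hpos) h0
    have hτK₀ : τ ∈ (sd K₀).faces := mem_sd_of_forall_mem_vertices h hτK hτv
    -- and `x` lies in that face
    have hwτ : ∀ u ∈ σ, u ∉ τ → w u = 0 := fun u hu hnot => by
      by_contra hwu
      exact hnot (Finset.mem_filter.2 ⟨hu, lt_of_le_of_ne (hw0 u hu) (Ne.symm hwu)⟩)
    have hsum : ∑ u ∈ τ, w u • u = ∑ u ∈ σ, w u • u :=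
      Finset.sum_subset hτσ fun u hu hnot => by rw [hwτ u hu hnot, zero_smul]
    have hsum1 : ∑ u ∈ τ, w u = 1 := by
      rw [← hw1]
      exact Finset.sum_subset hτσ fun u hu hnot => hwτ u hu hnot
    have hxτ : ∑ u ∈ σ, w u • u ∈ convexHull ℝ (τ : Set W) := by
      rw [← hsum]
      exact (convex_convexHull ℝ _).sum_mem (fun u hu => hw0 u (hτσ hu)) hsum1
        fun u hu => subset_convexHull ℝ _ hu
    rw [← space_sd K₀]
    exact (sd K₀).convexHull_subset_space hτK₀ hxτ
  · intro hx
    rw [← space_sd K₀] at hx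
    obtain ⟨τ, hτ, w, hw0, hw1, rfl⟩ := exists_eq_sum_smul_of_mem_space hx
    have hτK : τ ∈ (sd K).faces := sd_mono h hτ
    refine ⟨(sd K).convexHull_subset_space hτK ((convex_convexHull ℝ _).sum_mem hw0 hw1
      fun u hu => subset_convexHull ℝ _ hu), ?_⟩
    rw [awayFn_sum_smul hτK hw0 hw1]
    refine Finset.sum_eq_zero fun u hu => ?_
    rw [indicator_vertices_of_mem (mem_vertices_of_mem_face hτ hu), mul_zero]

/-! ### The theorem -/

/-- **A subcomplex is a strong deformation retract of arbitrarily small neighbourhoods in the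
polyhedron.** For a finite geometric simplicial complex `K`, a subcomplex `K₀ ≤ K` and an open
`O ⊇ |K₀|`, there is `V` with `|K₀| ⊆ V ⊆ |K| ∩ O`, relatively open in `|K|`, of which `|K₀|` is a
strong deformation retract (a sublevel set of the PL distance `awayFn K K₀` in the derived
subdivision). [cite: Munkres1984, Lemma 70.1] [cite: Dries1998, Ch. 8 (3.3)–(3.4)] -/
theorem exists_isStrongDeformationRetractOf_nhds_subcomplex (hfin : K.faces.Finite) (h : K₀ ≤ K)
    {O : Set W} (hO : IsOpen O) (hKO : K₀.space ⊆ O) :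
    ∃ V : Set W, K₀.space ⊆ V ∧ V ⊆ K.space ∩ O ∧ (∃ O' : Set W, IsOpen O' ∧ K.space ∩ O' = V) ∧
      IsStrongDeformationRetractOf K₀.space V := by
  have hfin' : (sd K).faces.Finite := finite_sd hfin
  have hℓ : ∀ s ∈ (sd K).faces, ∃ A : W →ᵃ[ℝ] ℝ, EqOn (awayFn K K₀) A (convexHull ℝ (s : Set W)) :=
    fun s hs => exists_affineMap_eqOn_awayFn hs
  have hℓ0 : ∀ v ∈ (sd K).vertices, 0 ≤ awayFn K K₀ v := fun v hv => awayFn_nonneg_of_mem_vertices hv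
  have hZ := setOf_awayFn_eq_zero h (K := K)
  have hZO : {x ∈ (sd K).space | awayFn K K₀ x = 0} ⊆ O := by rw [hZ]; exact hKO
  obtain ⟨ε, hε, hsub, hsdr⟩ := exists_isStrongDeformationRetractOf_nhds_zeroSet hfin' hℓ hℓ0 hO hZO
  obtain ⟨O', hO', hO'eq⟩ := exists_isOpen_inter_eq_sublevel hfin' hℓ ε
  rw [hZ] at hsdr
  refine ⟨{x ∈ (sd K).space | awayFn K K₀ x < ε}, ?_, ?_, ⟨O', hO', ?_⟩, hsdr⟩
  · intro x hx
    have hx' : x ∈ {x ∈ (sd K).space | awayFn K K₀ x = 0} := by rw [hZ]; exact hx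
    exact ⟨hx'.1, by rw [hx'.2]; exact hε⟩
  · intro x hx
    exact ⟨by rw [← space_sd K]; exact hx.1, hsub hx⟩
  · rw [← space_sd K]
    exact hO'eq

/-- **Corollary: cofinal retracting neighbourhoods of a subcomplex.** For `K` finite and `K₀ ≤ K`,
every neighbourhood (in `|K|`) of `|K₀|` contains a relatively open neighbourhood of `|K₀|` of which
`|K₀|` is a strong deformation retract — the shape of hypothesis (A') of
`Literature.AlgebraicGeometry.HodgeTheory.exists_homotopyEquiv_fiberToTube_of_retractingNhds`, read
in a triangulation. [cite: Munkres1984, Lemma 70.1] -/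
theorem exists_isStrongDeformationRetractOf_subset (hfin : K.faces.Finite) (h : K₀ ≤ K)
    {N : Set W} (hN : ∃ O : Set W, IsOpen O ∧ K₀.space ⊆ O ∧ K.space ∩ O ⊆ N) :
    ∃ V : Set W, K₀.space ⊆ V ∧ V ⊆ N ∧ (∃ O' : Set W, IsOpen O' ∧ K.space ∩ O' = V) ∧
      IsStrongDeformationRetractOf K₀.space V := by
  obtain ⟨O, hO, hKO, hON⟩ := hN
  obtain ⟨V, hKV, hVO, hV, hsdr⟩ := exists_isStrongDeformationRetractOf_nhds_subcomplex hfin h hO hKO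
  exact ⟨V, hKV, hVO.trans hON, hV, hsdr⟩

end SimplicialRetract

end Literature.AlgebraicTopology.Homotopy

end
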